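import Literature.MathematicalPhysics.QuantumFieldTheory.Federbush1986.PhaseCellIVGeomConstructions
import Literature.MathematicalPhysics.QuantumFieldTheory.Federbush1986.PhaseCellIVThmA1Small

/-!
# Federbush, *A phase cell approach to Yang–Mills theory. IV. The choice of variables* (CMP **114** (1988) 317–343) —
# §11 p. 338, GEOMETRIC CONSTRUCTION 4 («We extend `φ₂(x)` on `∂D` to `ᵉφ₂(x)` on `D`, satisfying (11.5) and (11.6)», `D` a
# `k`-cube): Theorem A.2 TRANSPORTED FROM THE BALL TO THE CUBE by an explicit bi-Lipschitz, boundary-preserving map, hence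
# PROVED (at unit scale) for every uniformly Lipschitz-retractable target and for all spheres

statement-level skeleton of published theorems with citation tags; proofs where landed; nothing here is a claim about the Yang–Mills mass gap

Cell `lit-balaban`, reader/typer block **r19** (F4 fold owner), SKELETON rows `F4.Def§11` (member: Construction 4) and
`F4.ThmA.2` of `run/shared/lean/pub/lit-balaban/lit-balaban-r19/ROWS-F4.md`.

**Source.** P. Federbush, Commun. Math. Phys. **114** (1988) 317–343 [bib `Federbush1988PhaseCellIV`; doi:10.1007/bf01225039;
journal page = PDF page + 316], p. 338 [PDF 22] (render `lit-balaban-r19/renders/f4/f4-p022.png`), verbatim: «We now go to the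
inductive step from edge (or surface) to surface (or volume). We denote this as the extension from `∂D` to `D`. … We now extend
the gauges of the other hypercubes containing `∂D`. Let `H₂` be one of these. *Geometric Construction 4.* We extend `φ₂(x)` on `∂D`
to `ᵉφ₂(x)` on `D`, satisfying (11.5) and (11.6).»; p. 337 (11.5) `d^g(ᵉφ₁, ᵉφ₂) ≤ c d^g(φ₁, φ₂)`, (11.6) `Λ₁(ᵉφ₂) ≤ c(Λ₁(ᵉφ₁) +
d^g(φ₁, φ₂)/L_r + Λ₁(φ₂))`; p. 339: «Caution. The geometric theorems of Appendix A, require a universal bound on `Λ₁` of `φ`'s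
(as scaled to unit scale)»; Appendix A part B «Geometric Constructions 2 and 4» = Theorem A.2 p. 341, stated for the unit BALL
`B`, while `D` in §11 / Theorem A.1 is the unit CUBE `D = {0 ≤ x_i ≤ 1}` (p. 339).

**What this file does.**  Print applies Theorem A.2 (ball) to cubes `D` without comment; the two are bi-Lipschitz equivalent
with boundary correspondence.  We make that explicit: `CubeBall.toBall x = 2|x − c|_∞ · (x − c)/|x − c|₂` (centre `c = (½,…,½)`)
maps `D = unitCube k` onto the closed unit ball and `∂D = cubeBoundary k` into the unit sphere and is `6`-Lipschitz; its inverse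
`CubeBall.toCube z = c + ½|z|₂ · z/|z|_∞` is `(3k/2)`-Lipschitz and maps the ball into `D`, the sphere into `∂D`
(`mem_cubeBoundary_iff`: `∂D` = the points of `D` with a coordinate in `{0, 1}`).  `GeomConstruction4 k t M` is (11.5)–(11.6)
for `∂D → D` at unit scale (`L_r = 1`), i.e. Theorem A.2's conclusion with `(B, ∂B)` replaced by `(D, ∂D)`, embedded reading
`M ⊆ Rᵗ`; `geomConstruction4_of_thmA2Emb : ThmA2Emb k t M → GeomConstruction4 k t M` (constants `ε = ε_M`,
`c = c₁ + 6c₂(3k/2 + 1)`), whence `geomConstruction4_of_retract` (every uniformly Lipschitz-retractable `M`) and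
`geomConstruction4_sphere` (all `S^{t−1}`, hypothesis-free).  (Construction 3, (11.7)–(11.8) `∂D → D` with `Λ₁(ᵉφ′₁) ≤ cΛ₁(φ′₁)`
«(But see caution …)», is at unit scale exactly the clause `ThmA1EmbAt k t M c₁` of `PhaseCellIVThmA1Small`.)
-/

namespace Literature.MathematicalPhysics.QuantumFieldTheory.Federbush1986

noncomputable section

open scoped NNReal ENNReal
open Set Metric

namespace PhaseCellIVAppA

/-! ## 1. Geometric Construction 4 = Theorem A.2 on the cube, unit scale -/

/-- **Geometric Construction 4** p. 338 («We extend `φ₂(x)` on `∂D` to `ᵉφ₂(x)` on `D`, satisfying (11.5) and (11.6)») at unit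
scale `L_r = 1` (p. 339 «as scaled to unit scale»), embedded reading: given `φ₁, φ₂ : ∂D → M` and an extension `ᵉφ₁ : D → M` of
`φ₁` with `d^g(φ₁, φ₂) ≤ ε`, there is an extension `ᵉφ₂` of `φ₂` with `d^g(ᵉφ₁, ᵉφ₂) ≤ c d^g(φ₁, φ₂)` (11.5) and
`Λ₁(ᵉφ₂) ≤ c(Λ₁(ᵉφ₁) + d^g(φ₁, φ₂) + Λ₁(φ₂))` (11.6) — Theorem A.2 (p. 341) with the ball replaced by the unit `k`-cube
`D = unitCube k`, `∂D = cubeBoundary k`; `ε`, `c` chosen before the maps.  `Prop`-valued definition.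
[cite: Federbush1988PhaseCellIV, Geometric Construction 4 p. 338; (11.5)–(11.6) p. 337; Theorem A.2 p. 341] -/
def GeomConstruction4 (k t : ℕ) (M : Set (EuclideanSpace ℝ (Fin t))) : Prop :=
  ∃ ε : ℝ≥0, 0 < ε ∧ ∃ c : ℝ≥0,
    ∀ (φ₁ φ₂ : ↥(cubeBoundary k) → ↥M) (eφ₁ : ↥(unitCube k) → ↥M),
      (∀ x : ↥(cubeBoundary k), eφ₁ ⟨x.1, cubeBoundary_subset k x.2⟩ = φ₁ x) →
      supDist φ₁ φ₂ ≤ ε →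
      ∃ eφ₂ : ↥(unitCube k) → ↥M,
        (∀ x : ↥(cubeBoundary k), eφ₂ ⟨x.1, cubeBoundary_subset k x.2⟩ = φ₂ x) ∧
        supDist eφ₁ eφ₂ ≤ c * supDist φ₁ φ₂ ∧
        lipConst eφ₂ ≤ c * (lipConst eφ₁ + supDist φ₁ φ₂ + lipConst φ₂)

namespace CubeBall

open ThmA2 GeomConstr ThmA1Small

/-! ## 2. The unit cube: centre, sup-norm size, boundary -/

variable {k : ℕ}

/-- The centre `c = (½, …, ½)` of the unit cube `D`. [cite: Federbush1988PhaseCellIV, Appendix A p. 339] -/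
def center (k : ℕ) : EuclideanSpace ℝ (Fin k) := WithLp.toLp 2 fun _ => (1 / 2 : ℝ)

/-- Coordinates of the centre. [cite: Federbush1988PhaseCellIV, Appendix A p. 339] -/
@[simp] theorem center_apply (i : Fin k) : center k i = 1 / 2 := rfl

/-- The sup-norm size `|y|_∞ = max_i |y_i|` of a vector of `ℝᵏ`. [cite: Federbush1988PhaseCellIV, Appendix A p. 339] -/
def supN (y : EuclideanSpace ℝ (Fin k)) : ℝ := ‖WithLp.ofLp y‖

/-- `|y|_∞ ≥ 0`. [cite: Federbush1988PhaseCellIV, Appendix A p. 339] -/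
theorem supN_nonneg (y : EuclideanSpace ℝ (Fin k)) : 0 ≤ supN y := norm_nonneg _

/-- `|y_i| ≤ |y|_∞`. [cite: Federbush1988PhaseCellIV, Appendix A p. 339] -/
theorem abs_apply_le_supN (y : EuclideanSpace ℝ (Fin k)) (i : Fin k) : |y i| ≤ supN y := by
  rw [← Real.norm_eq_abs]
  exact norm_le_pi_norm (WithLp.ofLp y) i

/-- `|y|_∞ ≤ |y|₂`. [cite: Federbush1988PhaseCellIV, Appendix A p. 339] -/
theorem supN_le_norm (y : EuclideanSpace ℝ (Fin k)) : supN y ≤ ‖y‖ :=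
  (pi_norm_le_iff_of_nonneg (norm_nonneg y)).mpr fun i => PiLp.norm_apply_le y i

/-- `|y|₂ ≤ √k |y|_∞`. [cite: Federbush1988PhaseCellIV, Appendix A p. 339] -/
theorem norm_le_sqrt_mul_supN (y : EuclideanSpace ℝ (Fin k)) : ‖y‖ ≤ Real.sqrt k * supN y :=
  norm_le_sqrt_mul y (supN_nonneg y) fun i => by rw [Real.norm_eq_abs]; exact abs_apply_le_supN y i

/-- `|toLp u|₂ ≤ √k |u|_∞` for `u : Fin k → ℝ`. [cite: Federbush1988PhaseCellIV, Appendix A p. 339] -/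
theorem norm_toLp_le (u : Fin k → ℝ) : ‖WithLp.toLp 2 u‖ ≤ Real.sqrt k * ‖u‖ :=
  norm_le_sqrt_mul_supN (WithLp.toLp 2 u)

/-- `||y|_∞ − |y′|_∞| ≤ |y − y′|₂`. [cite: Federbush1988PhaseCellIV, Appendix A p. 339] -/
theorem abs_supN_sub_supN_le (y y' : EuclideanSpace ℝ (Fin k)) : |supN y - supN y'| ≤ ‖y - y'‖ :=
  (abs_norm_sub_norm_le (WithLp.ofLp y) (WithLp.ofLp y')).trans (by rw [← WithLp.ofLp_sub]; exact supN_le_norm (y - y'))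

/-- `|y|_∞ = 0 ⇒ y = 0`. [cite: Federbush1988PhaseCellIV, Appendix A p. 339] -/
theorem eq_zero_of_supN_eq_zero {y : EuclideanSpace ℝ (Fin k)} (h : supN y = 0) : y = 0 := by
  have h1 : WithLp.ofLp y = 0 := norm_eq_zero.mp h
  rw [← WithLp.toLp_ofLp (p := 2) y, h1, WithLp.toLp_zero]

/-- In the unit cube `|x − c|_∞ ≤ ½`. [cite: Federbush1988PhaseCellIV, Appendix A p. 339] -/
theorem supN_sub_center_le {x : EuclideanSpace ℝ (Fin k)} (hx : x ∈ unitCube k) : supN (x - center k) ≤ 1 / 2 := by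
  refine (pi_norm_le_iff_of_nonneg (by norm_num)).mpr fun i => ?_
  have h := hx i
  rw [WithLp.ofLp_sub, Pi.sub_apply, Real.norm_eq_abs, abs_le]
  change -(1 / 2) ≤ x i - 1 / 2 ∧ x i - 1 / 2 ≤ 1 / 2
  constructor <;> linarith [h.1, h.2]

/-- `∂D` is the set of points of `D` having a coordinate equal to `0` or `1` (interior of a box = product of open intervals).
[cite: Federbush1988PhaseCellIV, Appendix A p. 339] -/
theorem mem_cubeBoundary_iff {x : EuclideanSpace ℝ (Fin k)} :
    x ∈ cubeBoundary k ↔ x ∈ unitCube k ∧ ∃ i, x i = 0 ∨ x i = 1 := by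
  have hcube : unitCube k = (WithLp.ofLp : EuclideanSpace ℝ (Fin k) → (Fin k → ℝ)) ⁻¹' (Set.univ.pi fun _ => Icc (0 : ℝ) 1) := by
    ext y
    simp only [unitCube, mem_setOf_eq, mem_preimage, mem_univ_pi]
  have hpre : cubeBoundary k =
      (WithLp.ofLp : EuclideanSpace ℝ (Fin k) → (Fin k → ℝ)) ⁻¹' frontier (Set.univ.pi fun _ : Fin k => Icc (0 : ℝ) 1) := by
    rw [cubeBoundary, hcube]
    exact ((EuclideanSpace.equiv (Fin k) ℝ).toHomeomorph.preimage_frontier _).symm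
  have hfr : frontier (Set.univ.pi fun _ : Fin k => Icc (0 : ℝ) 1) =
      (Set.univ.pi fun _ : Fin k => Icc (0 : ℝ) 1) \ Set.univ.pi fun _ : Fin k => Ioo (0 : ℝ) 1 := by
    rw [frontier, closure_pi_set, interior_pi_set finite_univ]
    simp only [closure_Icc, interior_Icc]
  rw [hpre, mem_preimage, hfr, Set.mem_sdiff, mem_univ_pi, mem_univ_pi]
  constructor
  · rintro ⟨h1, h2⟩
    refine ⟨fun i => h1 i, ?_⟩
    by_contra hne
    push Not at hne
    exact h2 fun i => ⟨lt_of_le_of_ne (h1 i).1 (Ne.symm (hne i).1), lt_of_le_of_ne (h1 i).2 (hne i).2⟩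
  · rintro ⟨h1, i, hi⟩
    refine ⟨fun i => h1 i, fun h2 => ?_⟩
    rcases hi with hi | hi
    · exact (h2 i).1.ne' hi
    · exact (h2 i).2.ne hi

/-- On `∂D`, `|x − c|_∞ = ½`. [cite: Federbush1988PhaseCellIV, Appendix A p. 339] -/
theorem supN_sub_center_eq {x : EuclideanSpace ℝ (Fin k)} (hx : x ∈ cubeBoundary k) : supN (x - center k) = 1 / 2 := by
  obtain ⟨hxD, i, hi⟩ := mem_cubeBoundary_iff.mp hx
  refine le_antisymm (supN_sub_center_le hxD) ?_
  have h := abs_apply_le_supN (x - center k) i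
  have hval : (x - center k) i = x i - 1 / 2 := rfl
  rw [hval] at h
  rcases hi with hi | hi <;> rw [hi] at h <;> norm_num at h <;> exact h

/-! ## 3. A Lipschitz bound for `y ↦ g(y) · y/|y|` -/

/-- `|y/|y|| ≤ 1` (value `0` at `y = 0`). [cite: Federbush1988PhaseCellIV, (A.22) p. 341] -/
theorem norm_radial_le_one {V : Type*} [NormedAddCommGroup V] [NormedSpace ℝ V] (y : V) : ‖radial y‖ ≤ 1 := by
  by_cases hy : y = 0
  · rw [hy, radial, smul_zero, norm_zero]
    exact zero_le_one
  · exact (norm_radial hy).le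

/-- `y/|y|` is invariant under positive dilations. [cite: Federbush1988PhaseCellIV, (A.22) p. 341] -/
theorem radial_smul_of_pos {V : Type*} [NormedAddCommGroup V] [NormedSpace ℝ V] {a : ℝ} (ha : 0 < a) (y : V) :
    radial (a • y) = radial y := by
  by_cases hy : y = 0
  · simp [radial, hy]
  · rw [radial, radial, norm_smul, Real.norm_of_nonneg ha.le, smul_smul, mul_inv, mul_assoc, mul_comm ‖y‖⁻¹ a,
      ← mul_assoc a⁻¹ a, inv_mul_cancel₀ ha.ne', one_mul]

/-- If `g ≥ 0` is `a`-Lipschitz with `g(y) ≤ a|y|`, then `y ↦ g(y) · y/|y|` is `3a`-Lipschitz (split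
`g(y)u(y) − g(y′)u(y′) = (g(y) − g(y′))u(y) + g(y′)(u(y) − u(y′))` with `|y′| ≤ |y|` and `|u(y) − u(y′)| ≤ 2|y − y′|/|y′|`).
[cite: Federbush1988PhaseCellIV, (A.22) p. 341] -/
theorem norm_scaledRadial_sub_le {V : Type*} [NormedAddCommGroup V] [NormedSpace ℝ V] {g : V → ℝ} {a : ℝ} (ha : 0 ≤ a)
    (hg : ∀ y y', |g y - g y'| ≤ a * ‖y - y'‖) (hg0 : ∀ y, 0 ≤ g y) (hgle : ∀ y, g y ≤ a * ‖y‖) (y y' : V) :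
    ‖g y • radial y - g y' • radial y'‖ ≤ 3 * a * ‖y - y'‖ := by
  wlog h : ‖y'‖ ≤ ‖y‖ generalizing y y'
  · have h' := this y' y (not_le.mp h).le
    rw [norm_sub_rev (g y' • radial y'), norm_sub_rev y'] at h'
    exact h'
  by_cases hy' : y' = 0
  · have h0 : g y' • radial y' = 0 := by rw [hy', radial, smul_zero, smul_zero]
    rw [h0, sub_zero, norm_smul, Real.norm_of_nonneg (hg0 y), hy', sub_zero]
    calc g y * ‖radial y‖ ≤ a * ‖y‖ * 1 := mul_le_mul (hgle y) (norm_radial_le_one y) (norm_nonneg _) (by positivity)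
      _ ≤ 3 * a * ‖y‖ := by nlinarith [norm_nonneg y]
  · have hρ : 0 < ‖y'‖ := norm_pos_iff.mpr hy'
    have hy0 : y ≠ 0 := by
      intro h0
      rw [h0, norm_zero] at h
      exact hy' (norm_le_zero_iff.mp h)
    have hsplit : g y • radial y - g y' • radial y' = (g y - g y') • radial y + g y' • (radial y - radial y') := by
      rw [sub_smul, smul_sub]
      abel
    rw [hsplit]
    calc ‖(g y - g y') • radial y + g y' • (radial y - radial y')‖
        ≤ ‖(g y - g y') • radial y‖ + ‖g y' • (radial y - radial y')‖ := norm_add_le _ _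
      _ = |g y - g y'| * ‖radial y‖ + g y' * ‖radial y - radial y'‖ := by
          rw [norm_smul, norm_smul, Real.norm_eq_abs, Real.norm_of_nonneg (hg0 y')]
      _ ≤ a * ‖y - y'‖ * 1 + a * ‖y'‖ * (2 / ‖y'‖ * ‖y - y'‖) :=
          add_le_add (mul_le_mul (hg y y') (norm_radial_le_one y) (norm_nonneg _) (mul_nonneg ha (norm_nonneg _)))
            (mul_le_mul (hgle y') (norm_radial_sub_radial_le hρ h le_rfl) (norm_nonneg _) (mul_nonneg ha (norm_nonneg _)))
      _ = 3 * a * ‖y - y'‖ := by field_simp; ring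

/-! ## 4. The maps `D → B` and `B → D` -/

/-- `D → B`: `x ↦ 2|x − c|_∞ · (x − c)/|x − c|₂`. [cite: Federbush1988PhaseCellIV, Theorem A.2 p. 341 vs. Theorem A.1 p. 339 (ball vs. cube)] -/
def toBall (x : EuclideanSpace ℝ (Fin k)) : EuclideanSpace ℝ (Fin k) := (2 * supN (x - center k)) • radial (x - center k)

/-- `B → D`: `z ↦ c + ½|z|₂ · z/|z|_∞`. [cite: Federbush1988PhaseCellIV, Theorem A.2 p. 341 vs. Theorem A.1 p. 339 (ball vs. cube)] -/
def toCube (z : EuclideanSpace ℝ (Fin k)) : EuclideanSpace ℝ (Fin k) :=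
  center k + WithLp.toLp 2 ((‖z‖ / 2) • radial (WithLp.ofLp z))

/-- `toBall` is `6`-Lipschitz. [cite: Federbush1988PhaseCellIV, Theorem A.2 p. 341] -/
theorem lipschitzWith_toBall : LipschitzWith 6 (toBall : EuclideanSpace ℝ (Fin k) → EuclideanSpace ℝ (Fin k)) := by
  refine LipschitzWith.of_dist_le_mul fun x x' => ?_
  rw [dist_eq_norm, dist_eq_norm, toBall, toBall]
  have h := norm_scaledRadial_sub_le (g := fun y : EuclideanSpace ℝ (Fin k) => 2 * supN y) (a := 2) (by norm_num)
    (fun y y' => by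
      rw [← mul_sub, abs_mul, abs_two]
      exact mul_le_mul_of_nonneg_left (abs_supN_sub_supN_le y y') (by norm_num))
    (fun y => by have := supN_nonneg y; positivity)
    (fun y => mul_le_mul_of_nonneg_left (supN_le_norm y) (by norm_num))
    (x - center k) (x' - center k)
  rw [show x - center k - (x' - center k) = x - x' by abel] at h
  calc ‖(2 * supN (x - center k)) • radial (x - center k) - (2 * supN (x' - center k)) • radial (x' - center k)‖
      ≤ 3 * 2 * ‖x - x'‖ := h
    _ = (6 : ℝ≥0) * ‖x - x'‖ := by norm_num

/-- `toCube` is `(3k/2)`-Lipschitz. [cite: Federbush1988PhaseCellIV, Theorem A.2 p. 341] -/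
theorem lipschitzWith_toCube :
    LipschitzWith ((3 / 2 : ℝ≥0) * k) (toCube : EuclideanSpace ℝ (Fin k) → EuclideanSpace ℝ (Fin k)) := by
  refine LipschitzWith.of_dist_le_mul fun z z' => ?_
  -- the sup-norm estimate for `u ↦ (|toLp u|₂/2) · u/|u|_∞`
  have hsq : 0 ≤ Real.sqrt k := Real.sqrt_nonneg _
  have h := norm_scaledRadial_sub_le (V := Fin k → ℝ) (g := fun u => ‖WithLp.toLp 2 u‖ / 2) (a := Real.sqrt k / 2)
    (by positivity)
    (fun u u' => by
      rw [← sub_div, abs_div, abs_two, div_le_iff₀ two_pos]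
      calc |‖WithLp.toLp 2 u‖ - ‖WithLp.toLp 2 u'‖| ≤ ‖WithLp.toLp 2 u - WithLp.toLp 2 u'‖ := abs_norm_sub_norm_le _ _
        _ = ‖WithLp.toLp 2 (u - u')‖ := by rw [WithLp.toLp_sub]
        _ ≤ Real.sqrt k * ‖u - u'‖ := norm_toLp_le _
        _ = Real.sqrt k / 2 * ‖u - u'‖ * 2 := by ring)
    (fun u => by positivity)
    (fun u => by
      rw [div_le_iff₀ two_pos]
      calc ‖WithLp.toLp 2 u‖ ≤ Real.sqrt k * ‖u‖ := norm_toLp_le u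
        _ = Real.sqrt k / 2 * ‖u‖ * 2 := by ring)
    (WithLp.ofLp z) (WithLp.ofLp z')
  simp only [WithLp.toLp_ofLp] at h
  have hdiff : toCube z - toCube z' =
      WithLp.toLp 2 ((‖z‖ / 2) • radial (WithLp.ofLp z) - (‖z'‖ / 2) • radial (WithLp.ofLp z')) := by
    rw [toCube, toCube, add_sub_add_left_eq_sub, WithLp.toLp_sub]
  have hzz : ‖WithLp.ofLp z - WithLp.ofLp z'‖ ≤ ‖z - z'‖ := by
    rw [← WithLp.ofLp_sub]; exact supN_le_norm (z - z')
  rw [dist_eq_norm, dist_eq_norm, hdiff]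
  calc ‖WithLp.toLp 2 ((‖z‖ / 2) • radial (WithLp.ofLp z) - (‖z'‖ / 2) • radial (WithLp.ofLp z'))‖
      ≤ Real.sqrt k * ‖(‖z‖ / 2) • radial (WithLp.ofLp z) - (‖z'‖ / 2) • radial (WithLp.ofLp z')‖ := norm_toLp_le _
    _ ≤ Real.sqrt k * (3 * (Real.sqrt k / 2) * ‖WithLp.ofLp z - WithLp.ofLp z'‖) := by gcongr
    _ ≤ Real.sqrt k * (3 * (Real.sqrt k / 2) * ‖z - z'‖) := by gcongr
    _ = ((3 / 2 : ℝ≥0) * k : ℝ≥0) * ‖z - z'‖ := by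
        have hk : Real.sqrt k * Real.sqrt k = k := Real.mul_self_sqrt (Nat.cast_nonneg k)
        push_cast
        linear_combination (3 / 2 * ‖z - z'‖) * hk

/-- `toBall` maps `D` into the closed unit ball (`|toBall x| = 2|x − c|_∞ ≤ 1`). [cite: Federbush1988PhaseCellIV, Theorem A.2 p. 341] -/
theorem toBall_mem_closedBall {x : EuclideanSpace ℝ (Fin k)} (hx : x ∈ unitCube k) :
    toBall x ∈ closedBall (0 : EuclideanSpace ℝ (Fin k)) 1 := by
  rw [mem_closedBall_zero_iff, toBall, norm_smul, Real.norm_of_nonneg (by have := supN_nonneg (x - center k); positivity)]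
  calc 2 * supN (x - center k) * ‖radial (x - center k)‖ ≤ 2 * (1 / 2) * 1 :=
        mul_le_mul (mul_le_mul_of_nonneg_left (supN_sub_center_le hx) (by norm_num)) (norm_radial_le_one _)
          (norm_nonneg _) (by norm_num)
    _ = 1 := by norm_num

/-- `toBall` maps `∂D` into the unit sphere (`|x − c|_∞ = ½` there). [cite: Federbush1988PhaseCellIV, Theorem A.2 p. 341] -/
theorem toBall_mem_sphere {x : EuclideanSpace ℝ (Fin k)} (hx : x ∈ cubeBoundary k) :
    toBall x ∈ sphere (0 : EuclideanSpace ℝ (Fin k)) 1 := by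
  have hs := supN_sub_center_eq hx
  have hy : x - center k ≠ 0 := by
    intro h0
    rw [h0] at hs
    simp [supN] at hs
  rw [mem_sphere_zero_iff_norm, toBall, norm_smul, hs, norm_radial hy]
  norm_num

/-- Coordinates of `toCube z`: `½ + (|z|₂/2)·(z/|z|_∞)_i`. [cite: Federbush1988PhaseCellIV, Theorem A.1 p. 339] -/
theorem toCube_apply (z : EuclideanSpace ℝ (Fin k)) (i : Fin k) :
    toCube z i = 1 / 2 + ‖z‖ / 2 * radial (WithLp.ofLp z) i := rfl

/-- The coordinates of `u/|u|_∞` are bounded by `1`. [cite: Federbush1988PhaseCellIV, Theorem A.1 p. 339] -/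
theorem abs_radial_apply_le_one (u : Fin k → ℝ) (i : Fin k) : |radial u i| ≤ 1 := by
  rw [← Real.norm_eq_abs]
  exact (norm_le_pi_norm (radial u) i).trans (norm_radial_le_one u)

/-- `toCube` maps the closed unit ball into `D`. [cite: Federbush1988PhaseCellIV, Theorem A.1 p. 339] -/
theorem toCube_mem_unitCube {z : EuclideanSpace ℝ (Fin k)} (hz : z ∈ closedBall (0 : EuclideanSpace ℝ (Fin k)) 1) :
    toCube z ∈ unitCube k := by
  rw [mem_closedBall_zero_iff] at hz
  intro i
  rw [toCube_apply]
  have h2 : |‖z‖ / 2 * radial (WithLp.ofLp z) i| ≤ 1 / 2 := by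
    rw [abs_mul, abs_of_nonneg (by positivity : (0 : ℝ) ≤ ‖z‖ / 2)]
    calc ‖z‖ / 2 * |radial (WithLp.ofLp z) i| ≤ 1 / 2 * 1 :=
          mul_le_mul (by linarith) (abs_radial_apply_le_one _ i) (abs_nonneg _) (by norm_num)
      _ = 1 / 2 := by norm_num
  rw [abs_le] at h2
  constructor <;> linarith [h2.1, h2.2]

/-- `toCube` maps the unit sphere into `∂D` (the coordinate where `|z_i| = |z|_∞` goes to `0` or `1`).
[cite: Federbush1988PhaseCellIV, Theorem A.1 p. 339] -/
theorem toCube_mem_cubeBoundary {z : EuclideanSpace ℝ (Fin k)} (hz : z ∈ sphere (0 : EuclideanSpace ℝ (Fin k)) 1) :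
    toCube z ∈ cubeBoundary k := by
  have hz1 : ‖z‖ = 1 := by simpa using hz
  refine mem_cubeBoundary_iff.mpr ⟨toCube_mem_unitCube (sphere_subset_closedBall hz), ?_⟩
  have hu0 : WithLp.ofLp z ≠ 0 := by
    intro h
    have : z = 0 := by rw [← WithLp.toLp_ofLp (p := 2) z, h, WithLp.toLp_zero]
    rw [this, norm_zero] at hz1
    exact zero_ne_one hz1
  -- an index where the sup norm is attained
  have hne : (Finset.univ : Finset (Fin k)).Nonempty := by
    by_contra hk
    rw [Finset.not_nonempty_iff_eq_empty, Finset.univ_eq_empty_iff] at hk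
    exact hu0 (funext fun i => (hk.false i).elim)
  obtain ⟨i, -, hi⟩ := Finset.exists_mem_eq_sup Finset.univ hne fun j => ‖WithLp.ofLp z j‖₊
  have hsup : ‖WithLp.ofLp z‖ = |WithLp.ofLp z i| := by
    rw [Pi.norm_def, hi, coe_nnnorm, Real.norm_eq_abs]
  have hspos : 0 < ‖WithLp.ofLp z‖ := norm_pos_iff.mpr hu0
  refine ⟨i, ?_⟩
  rw [toCube_apply, hz1, radial, Pi.smul_apply, smul_eq_mul]
  rcases le_or_gt 0 (WithLp.ofLp z i) with hpos | hneg
  · right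
    rw [abs_of_nonneg hpos] at hsup
    rw [← hsup, inv_mul_cancel₀ hspos.ne']
    norm_num
  · left
    rw [abs_of_neg hneg] at hsup
    rw [show WithLp.ofLp z i = -‖WithLp.ofLp z‖ by rw [hsup]; ring, mul_neg, inv_mul_cancel₀ hspos.ne']
    norm_num

/-- `toCube ∘ toBall = id` on `D`. [cite: Federbush1988PhaseCellIV, Theorem A.2 p. 341] -/
theorem toCube_toBall (x : EuclideanSpace ℝ (Fin k)) : toCube (toBall x) = x := by
  set y := x - center k with hy_def
  have hx : x = center k + y := by rw [hy_def]; abel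
  by_cases hy : y = 0
  · rw [toBall, ← hy_def, hy, radial, smul_zero, smul_zero, toCube, norm_zero, zero_div, zero_smul, WithLp.toLp_zero,
      add_zero, hx, hy, add_zero]
  · have hs : 0 < supN y := by
      rcases (supN_nonneg y).lt_or_eq with h | h
      · exact h
      · exact absurd (eq_zero_of_supN_eq_zero h.symm) hy
    have hn : 0 < ‖y‖ := norm_pos_iff.mpr hy
    -- `toBall x = (2|y|_∞/|y|₂) • y`
    have hb : toBall x = (2 * supN y / ‖y‖) • y := by
      rw [toBall, ← hy_def, radial, smul_smul, div_eq_mul_inv]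
    have hbn : ‖toBall x‖ = 2 * supN y := by
      rw [hb, norm_smul, Real.norm_of_nonneg (by positivity), div_mul_cancel₀ _ hn.ne']
    have hrad : radial (WithLp.ofLp (toBall x)) = (supN y)⁻¹ • WithLp.ofLp y := by
      rw [hb, WithLp.ofLp_smul, radial_smul_of_pos (by positivity), radial, supN]
    rw [toCube, hbn, hrad, smul_smul, show 2 * supN y / 2 * (supN y)⁻¹ = 1 by field_simp, one_smul, WithLp.toLp_ofLp, hx]

/-- `toBall ∘ toCube = id`. [cite: Federbush1988PhaseCellIV, Theorem A.2 p. 341] -/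
theorem toBall_toCube (z : EuclideanSpace ℝ (Fin k)) : toBall (toCube z) = z := by
  by_cases hz : z = 0
  · rw [hz, toCube, norm_zero, zero_div, zero_smul, WithLp.toLp_zero, add_zero, toBall, sub_self, radial, smul_zero,
      smul_zero]
  · have hu0 : WithLp.ofLp z ≠ 0 := by
      intro h
      exact hz (by rw [← WithLp.toLp_ofLp (p := 2) z, h, WithLp.toLp_zero])
    have hs : 0 < ‖WithLp.ofLp z‖ := norm_pos_iff.mpr hu0
    have hn : 0 < ‖z‖ := norm_pos_iff.mpr hz
    -- `toCube z − c = (|z|₂/(2|z|_∞)) • z`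
    have hy : toCube z - center k = (‖z‖ / 2 * ‖WithLp.ofLp z‖⁻¹) • z := by
      rw [toCube, add_sub_cancel_left, radial, smul_smul, WithLp.toLp_smul, WithLp.toLp_ofLp]
    have hcoef : 0 < ‖z‖ / 2 * ‖WithLp.ofLp z‖⁻¹ := by positivity
    have hsup : supN (toCube z - center k) = ‖z‖ / 2 := by
      rw [hy, supN, WithLp.ofLp_smul, norm_smul, Real.norm_of_nonneg hcoef.le, mul_assoc, inv_mul_cancel₀ hs.ne', mul_one]
    rw [toBall, hsup, hy, radial_smul_of_pos hcoef, radial, smul_smul,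
      show 2 * (‖z‖ / 2) * ‖z‖⁻¹ = 1 by field_simp, one_smul]

end CubeBall

/-! ## 5. Construction 4 from Theorem A.2 by transport along `toBall` / `toCube` -/

open CubeBall GeomConstr in
/-- **Geometric Construction 4 DERIVED from Theorem A.2 (embedded reading)**: `ThmA2Emb k t M → GeomConstruction4 k t M` with
`ε = ε_M` and `c = c₁ + 6c₂(3k/2 + 1)` — pull the three maps back to the ball along `toCube`, apply Theorem A.2, push the
extension forward along `toBall`; `Λ₁` changes by the Lipschitz constants `6` and `3k/2`, `d^g` not at all.
[cite: Federbush1988PhaseCellIV, Geometric Construction 4 p. 338; Theorem A.2 p. 341] -/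
theorem geomConstruction4_of_thmA2Emb {k t : ℕ} {M : Set (EuclideanSpace ℝ (Fin t))} (h : ThmA2Emb k t M) :
    GeomConstruction4 k t M := by
  obtain ⟨εM, hε, c₁, c₂, H⟩ := h
  set Kc : ℝ≥0 := (3 / 2 : ℝ≥0) * k
  refine ⟨εM, hε, c₁ + 6 * c₂ * (Kc + 1), fun φ₁ φ₂ eφ₁ hext hδ => ?_⟩
  -- transport maps on the subtypes
  set Ψs : ↥(sphere (0 : EuclideanSpace ℝ (Fin k)) 1) → ↥(cubeBoundary k) :=
    fun z => ⟨toCube z.1, toCube_mem_cubeBoundary z.2⟩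
  set Ψb : ↥(closedBall (0 : EuclideanSpace ℝ (Fin k)) 1) → ↥(unitCube k) :=
    fun z => ⟨toCube z.1, toCube_mem_unitCube z.2⟩
  set Φc : ↥(unitCube k) → ↥(closedBall (0 : EuclideanSpace ℝ (Fin k)) 1) :=
    fun x => ⟨toBall x.1, toBall_mem_closedBall x.2⟩
  have hΨsL : LipschitzWith Kc Ψs := LipschitzWith.of_dist_le_mul fun z z' => by
    rw [Subtype.dist_eq, Subtype.dist_eq z]
    exact lipschitzWith_toCube.dist_le_mul z.1 z'.1
  have hΨbL : LipschitzWith Kc Ψb := LipschitzWith.of_dist_le_mul fun z z' => by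
    rw [Subtype.dist_eq, Subtype.dist_eq z]
    exact lipschitzWith_toCube.dist_le_mul z.1 z'.1
  have hΦcL : LipschitzWith 6 Φc := LipschitzWith.of_dist_le_mul fun x x' => by
    rw [Subtype.dist_eq, Subtype.dist_eq x]
    exact lipschitzWith_toBall.dist_le_mul x.1 x'.1
  -- Theorem A.2 on the ball for the pulled-back maps
  have hgext : ∀ z : ↥(sphere (0 : EuclideanSpace ℝ (Fin k)) 1),
      (eφ₁ ∘ Ψb) ⟨z.1, sphere_subset_closedBall z.2⟩ = (φ₁ ∘ Ψs) z := fun z =>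
    hext ⟨toCube z.1, toCube_mem_cubeBoundary z.2⟩
  have hgδ : supDist (φ₁ ∘ Ψs) (φ₂ ∘ Ψs) ≤ supDist φ₁ φ₂ := supDist_comp_le φ₁ φ₂ Ψs
  obtain ⟨f₂e, hf₂ext, h18, h19⟩ := H (φ₁ ∘ Ψs) (φ₂ ∘ Ψs) (eφ₁ ∘ Ψb) hgext (hgδ.trans hδ)
  have hround : ∀ x : ↥(unitCube k), Ψb (Φc x) = x := fun x => Subtype.ext (toCube_toBall x.1)
  refine ⟨f₂e ∘ Φc, fun x => ?_, ?_, ?_⟩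
  · -- extension of `φ₂`
    have hS : toBall x.1 ∈ sphere (0 : EuclideanSpace ℝ (Fin k)) 1 := toBall_mem_sphere x.2
    have h1 : (f₂e ∘ Φc) ⟨x.1, cubeBoundary_subset k x.2⟩ = f₂e ⟨toBall x.1, sphere_subset_closedBall hS⟩ := rfl
    have h2 := hf₂ext ⟨toBall x.1, hS⟩
    have h3 : (φ₂ ∘ Ψs) ⟨toBall x.1, hS⟩ = φ₂ x := by
      show φ₂ (Ψs ⟨toBall x.1, hS⟩) = φ₂ x
      congr 1
      exact Subtype.ext (toCube_toBall x.1)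
    rw [h1, h2, h3]
  · -- (11.5)
    refine (iSup_le fun x => ?_).trans (h18.trans ?_)
    · have : eφ₁ x = (eφ₁ ∘ Ψb) (Φc x) := by
        show eφ₁ x = eφ₁ (Ψb (Φc x))
        rw [hround x]
      rw [this]
      exact edist_le_supDist (eφ₁ ∘ Ψb) f₂e (Φc x)
    · calc (c₁ : ℝ≥0∞) * supDist (φ₁ ∘ Ψs) (φ₂ ∘ Ψs) ≤ (c₁ : ℝ≥0∞) * supDist φ₁ φ₂ := by gcongr
        _ ≤ ((c₁ + 6 * c₂ * (Kc + 1) : ℝ≥0) : ℝ≥0∞) * supDist φ₁ φ₂ := by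
            gcongr
            exact_mod_cast le_self_add
  · -- (11.6)
    have hK1 : (Kc : ℝ≥0∞) ≤ (Kc + 1 : ℝ≥0) := by exact_mod_cast le_self_add
    have h1K : (1 : ℝ≥0∞) ≤ (Kc + 1 : ℝ≥0) := by exact_mod_cast le_add_self
    calc lipConst (f₂e ∘ Φc) ≤ (6 : ℝ≥0) * lipConst f₂e := lipConst_comp_le f₂e hΦcL
      _ ≤ (6 : ℝ≥0) * (c₂ * (lipConst (eφ₁ ∘ Ψb) + supDist (φ₁ ∘ Ψs) (φ₂ ∘ Ψs) + lipConst (φ₂ ∘ Ψs))) := by gcongr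
      _ ≤ (6 : ℝ≥0) * (c₂ * ((Kc : ℝ≥0∞) * lipConst eφ₁ + supDist φ₁ φ₂ + (Kc : ℝ≥0∞) * lipConst φ₂)) := by
          gcongr
          · exact lipConst_comp_le eφ₁ hΨbL
          · exact lipConst_comp_le φ₂ hΨsL
      _ ≤ (6 : ℝ≥0) * (c₂ * (((Kc + 1 : ℝ≥0) : ℝ≥0∞) * lipConst eφ₁ + ((Kc + 1 : ℝ≥0) : ℝ≥0∞) * supDist φ₁ φ₂ +
            ((Kc + 1 : ℝ≥0) : ℝ≥0∞) * lipConst φ₂)) := by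
          gcongr
          exact le_mul_of_one_le_left zero_le h1K
      _ = ((6 * c₂ * (Kc + 1) : ℝ≥0) : ℝ≥0∞) * (lipConst eφ₁ + supDist φ₁ φ₂ + lipConst φ₂) := by
          push_cast
          ring
      _ ≤ ((c₁ + 6 * c₂ * (Kc + 1) : ℝ≥0) : ℝ≥0∞) * (lipConst eφ₁ + supDist φ₁ φ₂ + lipConst φ₂) := by
          gcongr
          exact_mod_cast le_add_self

/-- **Geometric Construction 4 for every uniformly Lipschitz-retractable `M ⊆ Rᵗ`** and every cube dimension `k`.
[cite: Federbush1988PhaseCellIV, Geometric Construction 4 p. 338] -/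
theorem geomConstruction4_of_retract {k t : ℕ} {M : Set (EuclideanSpace ℝ (Fin t))} {r : ℝ} (hr : 0 < r) {L : ℝ≥0}
    {P : EuclideanSpace ℝ (Fin t) → EuclideanSpace ℝ (Fin t)} (hPL : LipschitzOnWith L P {y | infDist y M < r})
    (hPM : MapsTo P {y | infDist y M < r} M) (hPid : ∀ y ∈ M, P y = y) : GeomConstruction4 k t M :=
  geomConstruction4_of_thmA2Emb (thmA2Emb_of_retract hr hPL hPM hPid k)

/-- **Geometric Construction 4 for the model targets `S^{t−1}`** (every `k`, `t`; so for `U(1) = S¹`, `SU(2) ≅ S³`), hypothesis-free.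
[cite: Federbush1988PhaseCellIV, Geometric Construction 4 p. 338] -/
theorem geomConstruction4_sphere (k t : ℕ) : GeomConstruction4 k t (sphere (0 : EuclideanSpace ℝ (Fin t)) 1) :=
  geomConstruction4_of_thmA2Emb (thmA2Emb_sphere k t)

end PhaseCellIVAppA

end

end Literature.MathematicalPhysics.QuantumFieldTheory.Federbush1986
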